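import Mathlib
import Summits.MatrixMultiplication.MatrixMultiplication.Theorems.SubgroupIdentityDesigns.Negative.RankSplit
import Summits.MatrixMultiplication.MatrixMultiplication.Theorems.SubgroupIdentityDesigns.Negative.LeftKernelBound
import Summits.MatrixMultiplication.MatrixMultiplication.Theorems.SubgroupIdentityDesigns.Negative.LineRowsDesign

/-!
# The two-rank FAIL criterion for level-one identity designs in `GL₂(𝔽_p)` (soundness of the census certificate
format FL), with its linear-algebra core: reduction modulo a prime never increases the rank of an integer matrix
(negative-side lemmas for the crux `SubgroupIdentityDesigns`, stmt-MatrixMultiplication-14079; cell B2b-5, gen 8 —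
report `run/shared/lean/b2b/levelgraded-cu/ORACLE-g8.md`; certificate formats ORACLE-g7 §G7-1)

The exact census of the finite cell `(m,k,p) = (2,1,11)` refutes the identity-design clause triple by triple with two
certificate formats: GHOST (kernel-sound since gen 7, `FibreGhost`) and FR / FL = rank certificates.  An FL certificate
for subgroups `(H₁,H₂,H₃)` of `GL₂(𝔽_p)` consists of a finite set `T ⊆ S = H₁H₂H₃` of elements `a₀g₀` (`a₀ ∈ H₁`,
`g₀ ∈ H₃`), `k` ℤ-independent INTEGER left-kernel vectors of the census matrix `M_S` (rows = line indicators
`s ↦ [s u_l = w]`, `w ≠ 0`; columns = `S`), and the rank over SOME field `F` — the engine-free verifier uses `GF(2)` — of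
`M_S` restricted to the columns `S ∖ T`; it claims FAIL when `#rows < |T| + rank_F + k`.  The gen-7 chain
`DesignTranslate → LevelOneSpan → LineRows → LineRowsDesign → RankSplit → LeftKernelBound` is over `ℂ`; the one paper
step it left open was `rank_{GF(2)}(M mod 2) ≤ rank_ℂ(M)` for a 0/1 matrix.  This file closes it and assembles the
criterion.

`RankReduction` (pure linear algebra over `Mathlib`):
* `exists_lattice_factor` — every integer matrix `A` factors as `A = B * C` with `B = A * D` and the columns of `B`
  ℤ-linearly independent (a ℤ-basis of the column lattice, `Submodule.basisOfPid`);
* `rank_map_le_rank_map` — for ANY field `F` and any field `K` of characteristic zero,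
  `rank (A.map (Int.castRingHom F)) ≤ rank (A.map (Int.castRingHom K))`
  (`≤ r` from the factorisation; `r ≤` because ℤ-independent integer vectors stay independent over `K`,
  Mathlib `linearIndependent_algebraMap_comp_iff`);
* `finrank_span_indicator_le` — the row-space form for 0/1 matrices given by a predicate (the shape used by
  `RankSplit` / `LeftKernelBound`);
* `card_add_finrank_add_le_card` — the TWO-RANK INEQUALITY: if the `K`-row space (`char K = 0`) of a 0/1 matrix with
  row set `ι` contains the deltas of `T ⊆ S` and the matrix admits `k` ℤ-independent integer left-kernel relations,
  then `|T| + rank_F(rows restricted to S ∖ T) + k ≤ |ι|` for every field `F`.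

`TwoRankCriterion.no_levelOne_design_of_twoRank` (crux language, same design clause as
`FibreGhost.no_levelOne_design_of_fibreGhost`): under an FL certificate the identity-design clause of
`SubgroupIdentityDesigns` fails at `(m,k) = (2,1)` for `(H₁,H₂,H₃)`.  Proof = `LineRowsDesign` (a design puts every
`δ_{a₀g₀}` into the `ℂ`-row space) + `card_add_finrank_add_le_card` with `K = ℂ`.  With `FibreGhost` this makes BOTH
certificate formats of the `(2,1,11)` census kernel-sound: every census FAIL line is an instance of the hypotheses of
one of the two theorems, checked by an engine-free verifier in exact arithmetic.

Sorry-free; axioms `propext, Classical.choice, Quot.sound`.  VALUE = soundness theorem for a certificate format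
(decidable-verdict infrastructure), NOT summit progress.
-/

set_option linter.dupNamespace false

open scoped BigOperators
open Matrix

namespace Summit.MatrixMultiplication.MatrixMultiplication.Theorems.SubgroupIdentityDesigns.Negative

namespace RankReduction

section Factor

variable {m n : Type*} [Fintype m] [Fintype n]

/-- **Lattice factorisation.**  An integer matrix factors through a ℤ-basis of its column lattice:
`A = B * C`, `B = A * D`, columns of `B` ℤ-independent. -/
theorem exists_lattice_factor (A : Matrix m n ℤ) :
    ∃ (r : ℕ) (B : Matrix m (Fin r) ℤ) (C : Matrix (Fin r) n ℤ) (D : Matrix n (Fin r) ℤ),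
      A = B * C ∧ B = A * D ∧ LinearIndependent ℤ B.col := by
  set L : Submodule ℤ (m → ℤ) := Submodule.span ℤ (Set.range A.col) with hL
  obtain ⟨r, b⟩ := Submodule.basisOfPid (Pi.basisFun ℤ m) L
  have hcol : ∀ k : n, A.col k ∈ L := fun k => Submodule.subset_span ⟨k, rfl⟩
  have hb : ∀ j : Fin r, ∃ d : n → ℤ, ∑ k, d k • A.col k = ((b j : L) : m → ℤ) := fun j =>
    (Submodule.mem_span_range_iff_exists_fun ℤ).mp (b j).2
  choose d hd using hb
  refine ⟨r, Matrix.of fun i j => ((b j : L) : m → ℤ) i, Matrix.of fun j k => b.repr ⟨A.col k, hcol k⟩ j,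
    Matrix.of fun k j => d j k, ?_, ?_, ?_⟩
  · ext i k
    have h := b.sum_repr ⟨A.col k, hcol k⟩
    have h' := congrArg (fun v : L => ((v : L) : m → ℤ) i) h
    simp only [Submodule.coe_sum, Submodule.coe_smul, Finset.sum_apply, Pi.smul_apply, smul_eq_mul] at h'
    rw [Matrix.mul_apply]
    simp only [Matrix.of_apply]
    have hAik : A i k = A.col k i := rfl
    rw [hAik, ← h']
    exact Finset.sum_congr rfl fun j _ => mul_comm _ _
  · ext i j
    have h := congrFun (hd j) i
    simp only [Finset.sum_apply, Pi.smul_apply, smul_eq_mul] at h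
    rw [Matrix.mul_apply]
    simp only [Matrix.of_apply]
    rw [← h]
    exact Finset.sum_congr rfl fun k _ => mul_comm _ _
  · have hli : LinearIndependent ℤ (fun j => ((b j : L) : m → ℤ)) :=
      b.linearIndependent.map' L.subtype (Submodule.ker_subtype L)
    have hcolB : (Matrix.of fun i j => ((b j : L) : m → ℤ) i).col = fun j => ((b j : L) : m → ℤ) := by
      funext j i
      rfl
    rw [hcolB]
    exact hli

end Factor

section Rank

variable {m n : Type*} [Fintype m] [Fintype n]

/-- ℤ-independent integer columns stay independent over a characteristic-zero field. -/
theorem linearIndependent_col_map {r : ℕ} (B : Matrix m (Fin r) ℤ) (hB : LinearIndependent ℤ B.col)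
    (K : Type*) [Field K] [CharZero K] :
    LinearIndependent K (B.map (Int.castRingHom K)).col := by
  have h := (linearIndependent_algebraMap_comp_iff (R := ℤ) (S := K) (v := B.col)).mpr hB
  have e : (B.map (Int.castRingHom K)).col = fun i => algebraMap ℤ K ∘ B.col i := by
    funext i j
    simp [Matrix.col, Matrix.map_apply]
  rw [e]
  exact h

/-- A matrix with linearly independent columns over a field has rank the number of columns. -/
theorem rank_eq_card_of_linearIndependent_col {K : Type*} [Field K] (B : Matrix m n K)
    (hB : LinearIndependent K B.col) : B.rank = Fintype.card n := by
  have h : Bᵀ.rank = Fintype.card n := by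
    have hrow : LinearIndependent K Bᵀ.row := by simpa [Matrix.row_transpose] using hB
    exact hrow.rank_matrix
  rwa [Matrix.rank_transpose] at h

/-- **REDUCTION NEVER INCREASES RANK.**  For an integer matrix `A`, any field `F` and any field `K` of
characteristic zero: `rank (A over F) ≤ rank (A over K)`.  In particular `rank_{GF(2)}(A mod 2) ≤ rank_ℂ(A)`. -/
theorem rank_map_le_rank_map (A : Matrix m n ℤ) (F K : Type*) [Field F] [Field K] [CharZero K] :
    (A.map (Int.castRingHom F)).rank ≤ (A.map (Int.castRingHom K)).rank := by
  obtain ⟨r, B, C, D, hBC, hAD, hB⟩ := exists_lattice_factor A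
  have h1 : (A.map (Int.castRingHom F)).rank ≤ r := by
    rw [hBC, Matrix.map_mul]
    calc (B.map (Int.castRingHom F) * C.map (Int.castRingHom F)).rank
        ≤ (B.map (Int.castRingHom F)).rank := Matrix.rank_mul_le_left _ _
      _ ≤ Fintype.card (Fin r) := Matrix.rank_le_card_width _
      _ = r := Fintype.card_fin r
  have h2 : r ≤ (A.map (Int.castRingHom K)).rank := by
    have hrB : (B.map (Int.castRingHom K)).rank = r := by
      rw [rank_eq_card_of_linearIndependent_col _ (linearIndependent_col_map B hB K), Fintype.card_fin]
    calc r = (B.map (Int.castRingHom K)).rank := hrB.symm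
      _ = (A.map (Int.castRingHom K) * D.map (Int.castRingHom K)).rank := by rw [hAD, Matrix.map_mul]
      _ ≤ (A.map (Int.castRingHom K)).rank := Matrix.rank_mul_le_left _ _
  exact h1.trans h2

/-- Row-space form for 0/1 matrices given by a predicate (the shape of the census matrix `M_S`):
the `F`-dimension of the span of the indicator rows is at most the `K`-dimension, `char K = 0`. -/
theorem finrank_span_indicator_le {ι S : Type*} [Fintype ι] [Fintype S]
    (P : ι → S → Prop) [∀ i s, Decidable (P i s)] (F K : Type*) [Field F] [Field K] [CharZero K] :
    Module.finrank F (Submodule.span F (Set.range fun i : ι => fun s : S => if P i s then (1 : F) else 0)) ≤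
      Module.finrank K (Submodule.span K (Set.range fun i : ι => fun s : S => if P i s then (1 : K) else 0)) := by
  let A : Matrix ι S ℤ := Matrix.of fun i s => if P i s then 1 else 0
  have hF : (fun i : ι => fun s : S => if P i s then (1 : F) else 0) = (A.map (Int.castRingHom F)).row := by
    funext i s
    simp only [Matrix.row, Matrix.map_apply, Matrix.of_apply, A]
    split_ifs <;> simp
  have hK : (fun i : ι => fun s : S => if P i s then (1 : K) else 0) = (A.map (Int.castRingHom K)).row := by
    funext i s
    simp only [Matrix.row, Matrix.map_apply, Matrix.of_apply, A]
    split_ifs <;> simp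
  rw [hF, hK, ← Matrix.rank_eq_finrank_span_row, ← Matrix.rank_eq_finrank_span_row]
  exact rank_map_le_rank_map A F K

end Rank


section TwoRank

variable {ι S : Type*} [Fintype ι] [DecidableEq ι] [Fintype S] [DecidableEq S]

omit [DecidableEq ι] in
/-- ℤ-independent integer relation vectors stay independent over a characteristic-zero field. -/
theorem linearIndependent_intCast {k : ℕ} (α : Fin k → (ι → ℤ)) (hα : LinearIndependent ℤ α)
    (K : Type*) [Field K] [CharZero K] : LinearIndependent K (fun j => fun i => (α j i : K)) := by
  have h := (linearIndependent_algebraMap_comp_iff (R := ℤ) (S := K) (v := α)).mpr hα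
  have e : (fun j => fun i => (α j i : K)) = fun j => algebraMap ℤ K ∘ α j := by
    funext j i
    simp
  rw [e]
  exact h

/-- **TWO-RANK INEQUALITY (the FL certificate, kernel form).**  Let `M` be the 0/1 matrix of a predicate `P` with row
set `ι` and column set `S`, `K` a field of characteristic zero, `T ⊆ S`.  If the `K`-row space of `M` contains every
delta `δ_x`, `x ∈ T` (for the census matrix this is what a design forces, `LineRowsDesign`), and `k` ℤ-independent
INTEGER vectors `α_j` are left-kernel relations of `M` (`Σ_i α_j(i) M(i,s) = 0` for all `s`), then for EVERY field `F`
`|T| + rank_F(M restricted to the columns S ∖ T) + k ≤ |ι|`.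
Hence the certificate inequality `|ι| - k < |T| + rank_{GF(2)}(M_rest)` refutes the delta hypothesis. -/
theorem card_add_finrank_add_le_card (P : ι → S → Prop) [∀ i s, Decidable (P i s)]
    (K : Type*) [Field K] [CharZero K] (T : Finset S)
    (hT : ∀ x ∈ T, (Pi.single x (1 : K) : S → K) ∈
      Submodule.span K (Set.range fun i : ι => fun s : S => if P i s then (1 : K) else 0))
    {k : ℕ} (α : Fin k → (ι → ℤ)) (hα : LinearIndependent ℤ α)
    (hrel : ∀ j, ∀ s : S, ∑ i, α j i * (if P i s then (1 : ℤ) else 0) = 0)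
    (F : Type*) [Field F] :
    T.card + Module.finrank F (Submodule.span F (Set.range fun i : ι =>
        fun s : {s : S // s ∉ T} => if P i s then (1 : F) else 0)) + k ≤ Fintype.card ι := by
  set R : ι → (S → K) := fun i s => if P i s then (1 : K) else 0 with hR
  set V : Submodule K (S → K) := Submodule.span K (Set.range R) with hV
  set ρ : (S → K) →ₗ[K] ({s : S // s ∉ T} → K) := LinearMap.funLeft K K ((↑) : {s : S // s ∉ T} → S) with hρ
  have h1 := RankSplit.finrank_eq_card_add_finrank_restrict T V hT
  have hmap : V.map ρ = Submodule.span K (Set.range fun i : ι =>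
      fun s : {s : S // s ∉ T} => if P i s then (1 : K) else 0) := by
    rw [hV, Submodule.map_span, ← Set.range_comp]
    rfl
  have h2 := finrank_span_indicator_le (fun i (s : {s : S // s ∉ T}) => P i s) F K
  have hkerK : ∀ j, ∑ i, (fun i => (α j i : K)) i • R i = 0 := by
    intro j
    funext s
    have h := congrArg (Int.cast : ℤ → K) (hrel j s)
    push_cast at h
    simp only [Finset.sum_apply, Pi.smul_apply, smul_eq_mul, Pi.zero_apply]
    show ∑ i, (α j i : K) * (if P i s then (1 : K) else 0) = 0
    exact h
  have h3 := LeftKernelBound.finrank_span_add_le_card R (fun j i => (α j i : K))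
    (linearIndependent_intCast α hα K) hkerK
  rw [hmap] at h1
  rw [← hV] at h3
  omega

end TwoRank

end RankReduction

noncomputable section

open scoped Classical
open Summit.MatrixMultiplication.MatrixMultiplication.Theorems.LieRankDesigns.Negative (GLm Mat)

/-!  ## Crux-language form: the FL certificate refutes the level-one identity-design clause
(rows `ι = L × {w ≠ 0}` for lines `u_l` covering the non-zero vectors; columns = the subtype of triple products). -/

namespace TwoRankCriterion

variable {p : ℕ} [Fact p.Prime]

/-- **NO LEVEL-ONE IDENTITY DESIGN UNDER A TWO-RANK (FL) CERTIFICATE.**  Lines `u_l` covering the non-zero vectors,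
subgroups `H₁, H₂, H₃ ≤ GL₂(𝔽_p)`, `S` = the set of triple products, rows indexed by `ι = L × {w ≠ 0}`.
Given `T ⊆ S` inside `H₁H₃`, `k` ℤ-independent integer left-kernel relations of the census matrix on `S`, and a
field `F` with `|ι| < |T| + rank_F(rows restricted to S ∖ T) + k`, the design clause at `(2,1)` fails. -/
theorem no_levelOne_design_of_twoRank {L : Type*} [Fintype L] (u : L → (Fin 2 → ZMod p))
    (hu : ∀ a : Fin 2 → ZMod p, a ≠ 0 → ∃ l, ∃ c : ZMod p, c ≠ 0 ∧ a = c • u l)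
    (H₁ H₂ H₃ : Subgroup (GLm p 2))
    (T : Finset {s : CMat p 2 // ∃ a ∈ H₁, ∃ b ∈ H₂, ∃ g ∈ H₃, s = ((a * b * g : GLm p 2) : Mat p 2)})
    (hT : ∀ x ∈ T, ∃ a₀ ∈ H₁, ∃ g₀ ∈ H₃, (x : CMat p 2) = ((a₀ * g₀ : GLm p 2) : Mat p 2))
    {k : ℕ} (α : Fin k → (L × {w : Fin 2 → ZMod p // w ≠ 0} → ℤ)) (hα : LinearIndependent ℤ α)
    (hrel : ∀ j, ∀ s : {s : CMat p 2 // ∃ a ∈ H₁, ∃ b ∈ H₂, ∃ g ∈ H₃, s = ((a * b * g : GLm p 2) : Mat p 2)},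
      ∑ i : L × {w : Fin 2 → ZMod p // w ≠ 0},
        α j i * (if (s : CMat p 2).mulVec (u i.1) = i.2.1 then (1 : ℤ) else 0) = 0)
    (F : Type*) [Field F]
    (hlt : Fintype.card (L × {w : Fin 2 → ZMod p // w ≠ 0}) <
      T.card + Module.finrank F (Submodule.span F (Set.range fun i : L × {w : Fin 2 → ZMod p // w ≠ 0} =>
        fun s : {s : {s : CMat p 2 // ∃ a ∈ H₁, ∃ b ∈ H₂, ∃ g ∈ H₃, s = ((a * b * g : GLm p 2) : Mat p 2)} //
          s ∉ T} => if ((s : _) : CMat p 2).mulVec (u i.1) = i.2.1 then (1 : F) else 0)) + k) :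
    ¬ ∃ c : Matrix (Fin 2) (Fin 2) (ZMod p) → ℂ, (∀ M, 1 < M.rank → c M = 0) ∧
      (∑ M, c M * ZMod.stdAddChar (Matrix.trace (M * ((1 : GLm p 2) : Mat p 2)))) = 1 ∧
      ∀ a ∈ H₁, ∀ b ∈ H₂, ∀ g ∈ H₃, a * b * g ≠ 1 →
        (∑ M, c M * ZMod.stdAddChar
          (Matrix.trace (M * ((a * b * g : GLm p 2) : Mat p 2)))) = 0 := by
  rintro ⟨c, hc, hc1, hc0⟩
  have hf1 : fourierMat c 1 = 1 := by simpa [fourierMat] using hc1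
  have hf0 : ∀ a ∈ H₁, ∀ b ∈ H₂, ∀ g ∈ H₃, a * b * g ≠ 1 →
      fourierMat c ((a * b * g : GLm p 2) : Mat p 2) = 0 := by
    intro a ha b hb g hg hne
    simpa [fourierMat] using hc0 a ha b hb g hg hne
  -- the design puts every delta of T into the ℂ-row space (LineRowsDesign)
  have hTspan : ∀ x ∈ T, (Pi.single x (1 : ℂ) :
      {s : CMat p 2 // ∃ a ∈ H₁, ∃ b ∈ H₂, ∃ g ∈ H₃, s = ((a * b * g : GLm p 2) : Mat p 2)} → ℂ) ∈
      Submodule.span ℂ (Set.range fun i : L × {w : Fin 2 → ZMod p // w ≠ 0} =>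
        fun s : {s : CMat p 2 // ∃ a ∈ H₁, ∃ b ∈ H₂, ∃ g ∈ H₃, s = ((a * b * g : GLm p 2) : Mat p 2)} =>
          if (s : CMat p 2).mulVec (u i.1) = i.2.1 then (1 : ℂ) else 0) := by
    intro x hx
    obtain ⟨a₀, ha₀, g₀, hg₀, hx0⟩ := hT x hx
    have h : (fun s : {s : CMat p 2 // ∃ a ∈ H₁, ∃ b ∈ H₂, ∃ g ∈ H₃, s = ((a * b * g : GLm p 2) : Mat p 2)} =>
        if (s : CMat p 2) = ((a₀ * g₀ : GLm p 2) : Mat p 2) then (1 : ℂ) else 0) ∈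
        Submodule.span ℂ (Set.range fun lw : L × {w : Fin 2 → ZMod p // w ≠ 0} =>
          fun s : {s : CMat p 2 // ∃ a ∈ H₁, ∃ b ∈ H₂, ∃ g ∈ H₃, s = ((a * b * g : GLm p 2) : Mat p 2)} =>
            if (s : CMat p 2).mulVec (u lw.1) = lw.2.1 then (1 : ℂ) else 0) :=
      LineRows.single_mem_span_lineRows_of_design u hu c hc hf1 hf0 ha₀ hg₀
    have e : (Pi.single x (1 : ℂ) :
        {s : CMat p 2 // ∃ a ∈ H₁, ∃ b ∈ H₂, ∃ g ∈ H₃, s = ((a * b * g : GLm p 2) : Mat p 2)} → ℂ) =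
        fun s : {s : CMat p 2 // ∃ a ∈ H₁, ∃ b ∈ H₂, ∃ g ∈ H₃, s = ((a * b * g : GLm p 2) : Mat p 2)} =>
          if (s : CMat p 2) = ((a₀ * g₀ : GLm p 2) : Mat p 2) then (1 : ℂ) else 0 := by
      funext s
      rw [Pi.single_apply, ← hx0]
      by_cases hs : s = x
      · rw [if_pos hs, if_pos (by rw [hs])]
      · rw [if_neg hs, if_neg (fun h' => hs (Subtype.ext h'))]
    rw [e]
    exact h
  have hle := RankReduction.card_add_finrank_add_le_card
    (fun (i : L × {w : Fin 2 → ZMod p // w ≠ 0})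
      (s : {s : CMat p 2 // ∃ a ∈ H₁, ∃ b ∈ H₂, ∃ g ∈ H₃, s = ((a * b * g : GLm p 2) : Mat p 2)}) =>
      (s : CMat p 2).mulVec (u i.1) = i.2.1)
    ℂ T hTspan α hα hrel F
  omega

end TwoRankCriterion

end

end Summit.MatrixMultiplication.MatrixMultiplication.Theorems.SubgroupIdentityDesigns.Negative
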